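import Summits.CriticalPhenomena.PercolationContinuityZ3.Theorems.PercNearOneGluingNoHeavyLowerTailSahiLatinMoves

/-!
# `NoHeavyLowerTail` (crux stmt-CriticalPhenomena-4575), Sahi programme (prim-master-conj gen 42): the R/A-DESCENT THEOREM for the
# Latin kernel in EVERY dimension — `κ_d ≥ 0` on all up-set triples iff `κ_d ≥ 0` on the TERMINAL ones

Support file (`--supports stmt-CriticalPhenomena-4575`; companion of `…SahiLatinKernel`, `…SahiLatinMoves`).  Memo
`run/shared/lean/prim/prim-l12/FROM-prim-master-conj-g41-DESCENT.md` §2 (paper proof, here formalised).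

A triple `(a,b,c)` of subsets of `[3]^ι` is TERMINAL (`SahiLatin.Terminal`) if for each slot `s` with the other two `t, u`:
(C1) no minimal element of `s` lies in `t ∩ u` (`C1 s t u`), and (C2) every maximal element of the complement of `s` lies in `t ∩ u`
(`C2 s t u`).  By the move lemmas (`…SahiLatinMoves`): while some slot violates (C1), removing the offending minimal element keeps
up-sets and does not increase `κ` (phase R, `exists_terminal_le_of_C1` is then entered with (C1) everywhere); while some slot violates
(C2), adding the offending maximal non-element keeps up-sets, keeps (C1) in all slots (`C1_insert_left/mid/right`) and does not
increase `κ` (phase A).  Both phases terminate (`Σ|s|` falls, resp. `Σ|sᶜ|` falls).  Hence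

* `exists_terminal_le` — **every up-set triple descends to a terminal up-set triple with no larger `κ`**;
* `latinPos_iff_terminalPos` — **FBP(3,d) (`LatinPos ι`: `κ ≥ 0` on all up-set triples of `[3]^ι`) ⟺ terminal positivity**
  (`TerminalPos ι`).
The finite sets of terminal triples: `d = 2`: 39 (by hand, memo §3); `d = 3`: 16 491; `d = 4`: 76 380 564 165, all with `κ ≥ 0`
(computer enumeration, memo §4 — NOT a kernel fact).  With the all-`d` bridge (`…SahiLatinBridge`), `TerminalPos ι` implies Sahi's
`E₃ ≥ 0` on every product of `|ι|` finite chains with every product probability weight.  Everything here is proved; axioms standard.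
-/

namespace Summit.CriticalPhenomena.PercolationContinuityZ3.Theorems.SahiLatin

open Finset

variable {ι : Type*} [Fintype ι] [DecidableEq ι]

/-! ## Terminal triples -/

/-- `m` is a minimal element of `s`. [this work] -/
def IsMinOf (s : Finset (Pt ι)) (m : Pt ι) : Prop := m ∈ s ∧ ∀ y ∈ s, y ≤ m → y = m

/-- `m` is a maximal element of the complement of `s` (every strictly larger point lies in `s`). [this work] -/
def IsMaxOut (s : Finset (Pt ι)) (m : Pt ι) : Prop := m ∉ s ∧ ∀ y, m ≤ y → y ≠ m → y ∈ s

/-- Condition (C1) for the slot `s` against `t, u`: no minimal element of `s` lies in `t ∩ u` (no R-move available). [this work] -/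
def C1 (s t u : Finset (Pt ι)) : Prop := ∀ m, IsMinOf s m → ¬ (m ∈ t ∧ m ∈ u)

/-- Condition (C2) for the slot `s` against `t, u`: every maximal non-element of `s` lies in `t ∩ u` (no A-move available). [this work] -/
def C2 (s t u : Finset (Pt ι)) : Prop := ∀ m, IsMaxOut s m → m ∈ t ∧ m ∈ u

/-- A TERMINAL triple: (C1) and (C2) in each of the three slots. [this work] -/
structure Terminal (a b c : Finset (Pt ι)) : Prop where
  /-- (C1) for `a`. -/
  c1a : C1 a b c
  /-- (C1) for `b`. -/
  c1b : C1 b a c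
  /-- (C1) for `c`. -/
  c1c : C1 c a b
  /-- (C2) for `a`. -/
  c2a : C2 a b c
  /-- (C2) for `b`. -/
  c2b : C2 b a c
  /-- (C2) for `c`. -/
  c2c : C2 c a b

/-- A triple of up-sets. [this work] -/
def UpTriple (a b c : Finset (Pt ι)) : Prop :=
  IsUpperSet (a : Set (Pt ι)) ∧ IsUpperSet (b : Set (Pt ι)) ∧ IsUpperSet (c : Set (Pt ι))

/-- **FBP(3,d)**: the Latin kernel is nonnegative on every triple of up-sets of `[3]^ι`. [this work] -/
def LatinPos (ι : Type*) [Fintype ι] [DecidableEq ι] : Prop :=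
  ∀ a b c : Finset (Pt ι), UpTriple a b c → 0 ≤ kappa a b c

/-- TERMINAL POSITIVITY: the Latin kernel is nonnegative on every TERMINAL triple of up-sets of `[3]^ι`. [this work] -/
def TerminalPos (ι : Type*) [Fintype ι] [DecidableEq ι] : Prop :=
  ∀ a b c : Finset (Pt ι), UpTriple a b c → Terminal a b c → 0 ≤ kappa a b c

/-! ## (C1) is stable under A-moves -/

omit [Fintype ι] [DecidableEq ι] in
/-- (C1) is symmetric in the two reference sets. [this work] -/
theorem C1.symm {s t u : Finset (Pt ι)} (h : C1 s t u) : C1 s u t := fun m hm hmem => h m hm ⟨hmem.2, hmem.1⟩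

omit [DecidableEq ι] in
/-- A minimal element of `insert m s` is `m` or a minimal element of `s`. [this work] -/
theorem isMinOf_insert {s : Finset (Pt ι)} {m x : Pt ι} (hx : IsMinOf (insert m s) x) : x = m ∨ IsMinOf s x := by
  rcases mem_insert.1 hx.1 with h | h
  · exact Or.inl h
  · exact Or.inr ⟨h, fun y hy hyx => hx.2 y (mem_insert_of_mem hy) hyx⟩

omit [DecidableEq ι] in
/-- Adding to `s` a point outside `t ∩ u` preserves (C1) for `s`. [this work] -/
theorem C1_insert_left {s t u : Finset (Pt ι)} (h : C1 s t u) {m : Pt ι} (hm : ¬ (m ∈ t ∧ m ∈ u)) : C1 (insert m s) t u := by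
  intro x hx
  rcases isMinOf_insert hx with rfl | hx'
  · exact hm
  · exact h x hx'

omit [DecidableEq ι] in
/-- Adding to `t` a point outside `s ∩ u` preserves (C1) for `s` against `t, u`. [this work] -/
theorem C1_insert_mid {s t u : Finset (Pt ι)} (h : C1 s t u) {m : Pt ι} (hm : ¬ (m ∈ s ∧ m ∈ u)) : C1 s (insert m t) u := by
  intro x hx hmem
  rcases mem_insert.1 hmem.1 with rfl | hxt
  · exact hm ⟨hx.1, hmem.2⟩
  · exact h x hx ⟨hxt, hmem.2⟩

omit [DecidableEq ι] in
/-- Adding to `u` a point outside `s ∩ t` preserves (C1) for `s` against `t, u`. [this work] -/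
theorem C1_insert_right {s t u : Finset (Pt ι)} (h : C1 s t u) {m : Pt ι} (hm : ¬ (m ∈ s ∧ m ∈ t)) : C1 s t (insert m u) :=
  (C1_insert_mid h.symm hm).symm

/-! ## Cardinality bookkeeping -/

/-- Inserting a new point lowers the size of the complement by one. [this work] -/
theorem card_compl_insert_lt {s : Finset (Pt ι)} {m : Pt ι} (hm : m ∉ s) : (insert m s)ᶜ.card < sᶜ.card := by
  rw [compl_insert]
  exact card_erase_lt_of_mem (mem_compl.2 hm)

/-! ## Phase A: with (C1) everywhere, A-moves until (C2) everywhere -/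

/-- Phase A of the descent.  From an up-set triple satisfying (C1) in every slot, A-moves reach a terminal up-set triple with no
larger `κ` (strong induction on `|aᶜ| + |bᶜ| + |cᶜ|`). [this work] -/
theorem exists_terminal_le_of_C1 : ∀ (n : ℕ) (a b c : Finset (Pt ι)), aᶜ.card + bᶜ.card + cᶜ.card = n → UpTriple a b c →
    C1 a b c → C1 b a c → C1 c a b →
    ∃ a' b' c' : Finset (Pt ι), UpTriple a' b' c' ∧ Terminal a' b' c' ∧ kappa a' b' c' ≤ kappa a b c := by
  intro n
  induction n using Nat.strong_induction_on with
  | _ n ih =>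
    intro a b c hn hup h1a h1b h1c
    obtain ⟨ha, hb, hc⟩ := hup
    by_cases hA : ∃ m, IsMaxOut a m ∧ ¬ (m ∈ b ∧ m ∈ c)
    · obtain ⟨m, hm, hmbc⟩ := hA
      have hlt : (insert m a)ᶜ.card + bᶜ.card + cᶜ.card < n := by
        have := card_compl_insert_lt hm.1; omega
      obtain ⟨a', b', c', hup', hT, hle⟩ := ih _ hlt (insert m a) b c rfl
        ⟨isUpperSet_insert_of_maximal ha hm.2, hb, hc⟩ (C1_insert_left h1a hmbc) (C1_insert_mid h1b hmbc)
        (C1_insert_mid h1c fun h => hmbc ⟨h.2, h.1⟩)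
      exact ⟨a', b', c', hup', hT, hle.trans (kappa_insert_le hb hc hm.1 hmbc)⟩
    by_cases hB : ∃ m, IsMaxOut b m ∧ ¬ (m ∈ a ∧ m ∈ c)
    · obtain ⟨m, hm, hmac⟩ := hB
      have hlt : aᶜ.card + (insert m b)ᶜ.card + cᶜ.card < n := by
        have := card_compl_insert_lt hm.1; omega
      obtain ⟨a', b', c', hup', hT, hle⟩ := ih _ hlt a (insert m b) c rfl
        ⟨ha, isUpperSet_insert_of_maximal hb hm.2, hc⟩ (C1_insert_mid h1a hmac) (C1_insert_left h1b hmac)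
        (C1_insert_right h1c fun h => hmac ⟨h.2, h.1⟩)
      exact ⟨a', b', c', hup', hT, hle.trans (kappa_insert_le₂ ha hc hm.1 hmac)⟩
    by_cases hC : ∃ m, IsMaxOut c m ∧ ¬ (m ∈ a ∧ m ∈ b)
    · obtain ⟨m, hm, hmab⟩ := hC
      have hlt : aᶜ.card + bᶜ.card + (insert m c)ᶜ.card < n := by
        have := card_compl_insert_lt hm.1; omega
      obtain ⟨a', b', c', hup', hT, hle⟩ := ih _ hlt a b (insert m c) rfl
        ⟨ha, hb, isUpperSet_insert_of_maximal hc hm.2⟩ (C1_insert_right h1a hmab) (C1_insert_right h1b fun h => hmab ⟨h.2, h.1⟩)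
        (C1_insert_left h1c hmab)
      exact ⟨a', b', c', hup', hT, hle.trans (kappa_insert_le₃ ha hb hm.1 hmab)⟩
    push Not at hA hB hC
    exact ⟨a, b, c, ⟨ha, hb, hc⟩, ⟨h1a, h1b, h1c, hA, hB, hC⟩, le_rfl⟩

/-! ## Phase R: R-moves until (C1) everywhere, then phase A -/

/-- The full descent (strong induction on `|a| + |b| + |c|` for phase R, then `exists_terminal_le_of_C1`). [this work] -/
theorem exists_terminal_le_aux : ∀ (n : ℕ) (a b c : Finset (Pt ι)), a.card + b.card + c.card = n → UpTriple a b c →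
    ∃ a' b' c' : Finset (Pt ι), UpTriple a' b' c' ∧ Terminal a' b' c' ∧ kappa a' b' c' ≤ kappa a b c := by
  intro n
  induction n using Nat.strong_induction_on with
  | _ n ih =>
    intro a b c hn hup
    obtain ⟨ha, hb, hc⟩ := hup
    by_cases hA : ∃ m, IsMinOf a m ∧ (m ∈ b ∧ m ∈ c)
    · obtain ⟨m, hm, hmb, hmc⟩ := hA
      have hlt : (a.erase m).card + b.card + c.card < n := by
        have := card_erase_lt_of_mem hm.1; omega
      obtain ⟨a', b', c', hup', hT, hle⟩ := ih _ hlt (a.erase m) b c rfl ⟨isUpperSet_erase_of_minimal ha hm.2, hb, hc⟩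
      exact ⟨a', b', c', hup', hT, hle.trans (kappa_erase_le hm.1 hmb hmc)⟩
    by_cases hB : ∃ m, IsMinOf b m ∧ (m ∈ a ∧ m ∈ c)
    · obtain ⟨m, hm, hma, hmc⟩ := hB
      have hlt : a.card + (b.erase m).card + c.card < n := by
        have := card_erase_lt_of_mem hm.1; omega
      obtain ⟨a', b', c', hup', hT, hle⟩ := ih _ hlt a (b.erase m) c rfl ⟨ha, isUpperSet_erase_of_minimal hb hm.2, hc⟩
      exact ⟨a', b', c', hup', hT, hle.trans (kappa_erase_le₂ hm.1 hma hmc)⟩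
    by_cases hC : ∃ m, IsMinOf c m ∧ (m ∈ a ∧ m ∈ b)
    · obtain ⟨m, hm, hma, hmb⟩ := hC
      have hlt : a.card + b.card + (c.erase m).card < n := by
        have := card_erase_lt_of_mem hm.1; omega
      obtain ⟨a', b', c', hup', hT, hle⟩ := ih _ hlt a b (c.erase m) rfl ⟨ha, hb, isUpperSet_erase_of_minimal hc hm.2⟩
      exact ⟨a', b', c', hup', hT, hle.trans (kappa_erase_le₃ hm.1 hma hmb)⟩
    push Not at hA hB hC
    exact exists_terminal_le_of_C1 _ a b c rfl ⟨ha, hb, hc⟩ (fun m hm h => hA m hm h.1 h.2) (fun m hm h => hB m hm h.1 h.2)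
      (fun m hm h => hC m hm h.1 h.2)

/-- **DESCENT THEOREM** (all `d`).  Every triple of up-sets of `[3]^ι` descends, by R-moves then A-moves, to a TERMINAL triple of
up-sets with no larger Latin kernel. [this work] -/
theorem exists_terminal_le {a b c : Finset (Pt ι)} (hup : UpTriple a b c) :
    ∃ a' b' c' : Finset (Pt ι), UpTriple a' b' c' ∧ Terminal a' b' c' ∧ kappa a' b' c' ≤ kappa a b c :=
  exists_terminal_le_aux _ a b c rfl hup

/-- **FBP(3,d) ⟺ terminal positivity** (all `d`): the Latin kernel is nonnegative on all up-set triples of `[3]^ι` iff it is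
nonnegative on the terminal ones. [this work] -/
theorem latinPos_iff_terminalPos : LatinPos ι ↔ TerminalPos ι := by
  constructor
  · exact fun h a b c hup _ => h a b c hup
  · intro h a b c hup
    obtain ⟨a', b', c', hup', hT, hle⟩ := exists_terminal_le hup
    exact (h a' b' c' hup' hT).trans hle

end Summit.CriticalPhenomena.PercolationContinuityZ3.Theorems.SahiLatin
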